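import Literature.Probability.Percolation.SlabRSWCase3Crossing
import HarnessLib

/-!
# Newman–Tassion–Wu 2017, Lemma 3.16 — the gluing datum on a coarse-grained domain `R' ∖ N(Γ)`

Topic: `Literature/Probability/Percolation`. NTW prove Lemma 3.16 (the gluing step of Case 3 of
Theorem 3.14, arXiv:1512.09107 p. 16) by applying the gluing lemma GL0 "in the domain `K_□`, which is
regular enough" — `K_□` being a union of grid-aligned boxes `B_r(z)`, `z ∈ 2rℤ²`, inside
`K(γ) = R ∖ 𝒩(γ̄, 3r)`. The tree's reduction of Case 3 (`SlabRSWExploration/Case3Separation/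
Case3Crossing/Lemma316.lean`) uses the datum `mirrorGlue` whose path domain is `R' ∖ 𝒩(Γ, ρ₂)`
itself; at the scale of one local modification that domain has unit staircases (the sup-norm
neighbourhood of a lattice path), so the local surgery has no uniform geometry there. This file sets up
NTW's coarse-graining in a form where every local picture is rectilinear AT MESH 40:

* the coarse lattice `Λ = (7n + c + 40ℤ) × 40ℤ`, symmetric under the mirror `τ : x ↦ 14n - x`, with
  the offset `c = snapOff n ∈ {0, 20}` chosen so that no lattice abscissa lies in `{1,2,3}` (nor, by
  symmetry, in `{14n-3, 14n-2, 14n-1}`): `snapOff`, `OnLatX`, `OnLatY`;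
* the snapping `snap n p ∈ Λ` of a planar point (`|snap p - p|∞ ≤ 20`, and `(snap p).1 ≤ 7n` when
  `p.1 ≤ 7n`), the TILE `sqBox (snap n p) 40`, and the coarse neighbourhood
  `N(Γ) = snapNbhd n Γ = ⋃_{g ∈ Γ} sqBox (snap (planar g)) 40` of a path with its mirror image
  `snapNbhdR n Γ = τ N(Γ)`;
* the gluing datum **`snapGlue n hn Γ`** `= (S = R' ∖ N(Γ), R = R', A = C, B = τN(Γ) ∖ N(Γ), C = τC)`
  (fat target: the mirror tiles), replacing `mirrorGlue n hn Γ ρ₂`;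
* the facts used downstream: `Γ̄ ⊆ N(Γ) ⊆ 𝒩(Γ, 60)`; `τN ∖ N ⊆ {x ≥ 7n+1}` and `N ∖ τN ⊆ {x ≤ 7n-1}`
  when `Γ ⊆ {x ≤ 7n}` (the mirror of a point right of the axis is no farther from a centre left of the
  axis); tiles have their sides on `Λ`.

## Sources

* C. M. Newman, V. Tassion, W. Wu, *Critical percolation and the minimal spanning tree in slabs*,
  Comm. Pure Appl. Math. 70 (2017), arXiv:1512.09107: §3.5, Lemma 3.16 and its proof (the sets
  `K(γ)`, `K_□ = ⋃_{z ∈ 2rℤ², B̄_r(z) ⊆ K(γ)} B̄_r(z)`, "the domain `K_□` is regular enough to apply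
  Theorem 3.6", Remark 2 after Theorem 3.7) [NewmanTassionWu2017].

## Design choices

All mesh constants are numerals (`40`, `20`, `19`) so that `omega` discharges the lattice arithmetic
(`Int` division and remainder by numerals). The offset depends on `n` (two admissible values), the
mesh does not, so the gadget radius — hence the constant of the gluing bound — is uniform in `n`.
-/

noncomputable section

namespace Literature.Probability.Percolation

open MeasureTheory LatticeModels SimpleGraph

namespace NTW17

variable {k : ℕ}

/-! ## The coarse lattice -/

section Lattice

/-- **The offset of the coarse lattice**: `20` if `7n ≡ 1, 2, 3 (mod 40)`, else `0`; then no point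
of `7n + c + 40ℤ` lies in `{1,2,3}`. [cite: NewmanTassionWu2017, §3.5 (proof of Lemma 3.16, the grid 2rℤ²)] -/
def snapOff (n : ℕ) : ℤ :=
  if (7 * (n : ℤ)) % 40 = 1 ∨ (7 * (n : ℤ)) % 40 = 2 ∨ (7 * (n : ℤ)) % 40 = 3 then 20 else 0

/-- The abscissae of the coarse lattice: `x ∈ 7n + c + 40ℤ`. [cite: NewmanTassionWu2017, §3.5 (proof of Lemma 3.16, the grid 2rℤ²)] -/
def OnLatX (n : ℕ) (x : ℤ) : Prop := (40 : ℤ) ∣ x - 7 * n - snapOff n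

/-- The ordinates of the coarse lattice: `y ∈ 40ℤ`. [cite: NewmanTassionWu2017, §3.5 (proof of Lemma 3.16, the grid 2rℤ²)] -/
def OnLatY (y : ℤ) : Prop := (40 : ℤ) ∣ y

/-- The offset is `0` or `20`. [cite: NewmanTassionWu2017, §3.5 (proof of Lemma 3.16)] -/
theorem snapOff_eq (n : ℕ) : snapOff n = 0 ∨ snapOff n = 20 := by
  unfold snapOff; split_ifs <;> simp

/-- The offset against the residue of `7n` modulo `40`: writing `7n = 40q + r` (`0 ≤ r ≤ 39`), the
offset is `20` exactly when `r ∈ {1,2,3}`. [cite: NewmanTassionWu2017, §3.5 (proof of Lemma 3.16)] -/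
theorem snapOff_spec (n : ℕ) : ∃ q r : ℤ, 7 * (n : ℤ) = 40 * q + r ∧ 0 ≤ r ∧ r ≤ 39 ∧
    ((snapOff n = 20 ∧ 1 ≤ r ∧ r ≤ 3) ∨ (snapOff n = 0 ∧ ¬(1 ≤ r ∧ r ≤ 3))) := by
  refine ⟨7 * (n : ℤ) / 40, 7 * (n : ℤ) % 40, by omega, by omega, by omega, ?_⟩
  unfold snapOff
  split_ifs with h
  · left; exact ⟨rfl, by omega⟩
  · right; exact ⟨rfl, by omega⟩

/-- **No lattice abscissa in `{1,2,3}`.** [cite: NewmanTassionWu2017, §3.5 (proof of Lemma 3.16)] -/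
theorem not_onLatX_small (n : ℕ) {x : ℤ} (hx : OnLatX n x) : ¬(1 ≤ x ∧ x ≤ 3) := by
  rintro ⟨h1, h3⟩
  obtain ⟨j, hj⟩ := hx
  obtain ⟨q, r, hqr, hr0, hr1, hc⟩ := snapOff_spec n
  obtain ⟨s, hs⟩ : ∃ s : ℤ, x - snapOff n - r = 40 * s := ⟨j + q, by linarith⟩
  clear hj hqr
  rcases hc with ⟨h, h', h''⟩ | ⟨h, h'⟩
  · rw [h] at hs; omega
  · rw [h] at hs; omega

/-- The lattice abscissae are symmetric under the mirror `x ↦ 14n - x`.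
[cite: NewmanTassionWu2017, §3.5 (proof of Lemma 3.16, symmetry through the axis)] -/
theorem onLatX_reflect (n : ℕ) {x : ℤ} (hx : OnLatX n x) : OnLatX n (14 * n - x) := by
  obtain ⟨j, hj⟩ := hx
  rcases snapOff_eq n with h | h
  · refine ⟨-j, ?_⟩; rw [h] at hj ⊢; linarith
  · refine ⟨-j - 1, ?_⟩; rw [h] at hj ⊢; linarith

/-- **No lattice abscissa in `{14n-3, 14n-2, 14n-1}`.** [cite: NewmanTassionWu2017, §3.5 (proof of Lemma 3.16)] -/
theorem not_onLatX_large (n : ℕ) {x : ℤ} (hx : OnLatX n x) : ¬(14 * n - 3 ≤ x ∧ x ≤ 14 * n - 1) := by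
  rintro ⟨h1, h3⟩
  exact not_onLatX_small n (onLatX_reflect n hx) ⟨by omega, by omega⟩

/-- No lattice ordinate in `{1,2,3}`. [cite: NewmanTassionWu2017, §3.5 (proof of Lemma 3.16)] -/
theorem not_onLatY_small {y : ℤ} (hy : OnLatY y) : ¬(1 ≤ y ∧ y ≤ 3) := by
  rintro ⟨h1, h3⟩; obtain ⟨j, hj⟩ := hy; omega

/-- Two lattice abscissae within `39` of each other coincide. [cite: NewmanTassionWu2017, §3.5 (proof of Lemma 3.16)] -/
theorem onLatX_unique (n : ℕ) {x x' : ℤ} (hx : OnLatX n x) (hx' : OnLatX n x') (h : x' ≤ x + 39)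
    (h' : x ≤ x' + 39) : x = x' := by
  obtain ⟨j, hj⟩ := hx; obtain ⟨j', hj'⟩ := hx'; omega

/-- Two lattice ordinates within `39` of each other coincide. [cite: NewmanTassionWu2017, §3.5 (proof of Lemma 3.16)] -/
theorem onLatY_unique {y y' : ℤ} (hy : OnLatY y) (hy' : OnLatY y') (h : y' ≤ y + 39) (h' : y ≤ y' + 39) :
    y = y' := by
  obtain ⟨j, hj⟩ := hy; obtain ⟨j', hj'⟩ := hy'; omega

/-- Lattice abscissae are `40` apart: `x + 40 ∈ Λ₁`. [cite: NewmanTassionWu2017, §3.5 (proof of Lemma 3.16)] -/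
theorem onLatX_add (n : ℕ) {x : ℤ} (hx : OnLatX n x) (j : ℤ) : OnLatX n (x + 40 * j) := by
  obtain ⟨i, hi⟩ := hx; exact ⟨i + j, by rw [mul_add, ← hi]; ring⟩

/-- Lattice ordinates are `40` apart. [cite: NewmanTassionWu2017, §3.5 (proof of Lemma 3.16)] -/
theorem onLatY_add {y : ℤ} (hy : OnLatY y) (j : ℤ) : OnLatY (y + 40 * j) := by
  obtain ⟨i, hi⟩ := hy; exact ⟨i + j, by rw [mul_add, ← hi]⟩

end Lattice

/-! ## Snapping a point to the lattice; tiles -/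

section Snap

/-- **Snapping** a planar point to the coarse lattice: the largest lattice point `≤ p + 19` in each
coordinate (so `snap p - 19 ≤ p ≤ snap p + 20` coordinatewise).
[cite: NewmanTassionWu2017, §3.5 (proof of Lemma 3.16, the grid boxes B_r(z), z ∈ 2rℤ²)] -/
def snap (n : ℕ) (p : ℤ × ℤ) : ℤ × ℤ :=
  (7 * n + snapOff n + 40 * ((p.1 - 7 * n - snapOff n + 19) / 40), 40 * ((p.2 + 19) / 40))

/-- The snapped abscissa is on the lattice. [cite: NewmanTassionWu2017, §3.5 (proof of Lemma 3.16)] -/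
theorem onLatX_snap (n : ℕ) (p : ℤ × ℤ) : OnLatX n (snap n p).1 :=
  ⟨(p.1 - 7 * n - snapOff n + 19) / 40, by simp only [snap]; ring⟩

/-- The snapped ordinate is on the lattice. [cite: NewmanTassionWu2017, §3.5 (proof of Lemma 3.16)] -/
theorem onLatY_snap (n : ℕ) (p : ℤ × ℤ) : OnLatY (snap n p).2 :=
  ⟨(p.2 + 19) / 40, by simp only [snap]⟩

/-- The snapped abscissa, unfolded. [cite: NewmanTassionWu2017, §3.5 (proof of Lemma 3.16)] -/
theorem snap_fst (n : ℕ) (p : ℤ × ℤ) :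
    (snap n p).1 = 7 * n + snapOff n + 40 * ((p.1 - 7 * n - snapOff n + 19) / 40) := rfl

/-- The snapped ordinate, unfolded. [cite: NewmanTassionWu2017, §3.5 (proof of Lemma 3.16)] -/
theorem snap_snd (n : ℕ) (p : ℤ × ℤ) : (snap n p).2 = 40 * ((p.2 + 19) / 40) := rfl

/-- `snap p` is within `20` of `p`, coordinatewise (`snap p - 19 ≤ p ≤ snap p + 20`).
[cite: NewmanTassionWu2017, §3.5 (proof of Lemma 3.16)] -/
theorem snap_bounds (n : ℕ) (p : ℤ × ℤ) :
    (snap n p).1 - 19 ≤ p.1 ∧ p.1 ≤ (snap n p).1 + 20 ∧ (snap n p).2 - 19 ≤ p.2 ∧ p.2 ≤ (snap n p).2 + 20 := by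
  rw [snap_fst, snap_snd]
  refine ⟨by omega, by omega, by omega, by omega⟩

/-- A point lies in its own tile, with room: `sqBox p 20 ⊆ sqBox (snap p) 40`.
[cite: NewmanTassionWu2017, §3.5 (proof of Lemma 3.16)] -/
theorem sqBox_subset_tile (n : ℕ) (p : ℤ × ℤ) : sqBox p 20 ⊆ sqBox (snap n p) 40 := by
  intro z hz
  have := snap_bounds n p
  rw [mem_sqBox_iff'] at hz ⊢; push_cast at hz ⊢; omega

/-- A point lies in its own tile. [cite: NewmanTassionWu2017, §3.5 (proof of Lemma 3.16)] -/
theorem mem_tile_self (n : ℕ) (p : ℤ × ℤ) : p ∈ sqBox (snap n p) 40 :=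
  sqBox_subset_tile n p (mem_sqBox_self _ _)

/-- A tile is within `60` of the point it was snapped from. [cite: NewmanTassionWu2017, §3.5 (proof of Lemma 3.16)] -/
theorem tile_subset_sqBox (n : ℕ) (p : ℤ × ℤ) : sqBox (snap n p) 40 ⊆ sqBox p 60 := by
  intro z hz
  have := snap_bounds n p
  rw [mem_sqBox_iff'] at hz ⊢; push_cast at hz ⊢; omega

/-- **Snapping does not cross the axis**: `p.1 ≤ 7n ⟹ (snap p).1 ≤ 7n`.
[cite: NewmanTassionWu2017, §3.5 (proof of Lemma 3.16, symmetry through the axis)] -/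
theorem snap_fst_le (n : ℕ) {p : ℤ × ℤ} (hp : p.1 ≤ 7 * n) : (snap n p).1 ≤ 7 * n := by
  rw [snap_fst]
  obtain ⟨q, r, hqr, hr0, hr1, hc⟩ := snapOff_spec n
  set d := (p.1 - 7 * n - snapOff n + 19) / 40 with hd
  have hd1 : 40 * d ≤ p.1 - 7 * n - snapOff n + 19 := by omega
  clear hqr hd
  rcases hc with ⟨h, h', h''⟩ | ⟨h, h'⟩
  · rw [h] at hd1 ⊢; omega
  · rw [h] at hd1 ⊢; omega

/-- **The mirror of a point right of the axis is no farther from a centre left of the axis**: if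
`c.1 ≤ 7n ≤ q.1` and `q ∈ sqBox c r` then `τ q = (14n - q.1, q.2) ∈ sqBox c r`.
[cite: NewmanTassionWu2017, §3.5 (proof of Lemma 3.16, symmetry through the axis)] -/
theorem reflect_mem_sqBox_of_le {n : ℕ} {c q : ℤ × ℤ} {r : ℕ} (hc : c.1 ≤ 7 * n) (hq : 7 * n ≤ q.1)
    (h : q ∈ sqBox c r) : planarReflect (14 * (n : ℤ)) q ∈ sqBox c r := by
  rw [mem_sqBox_iff'] at h ⊢
  simp only [planarReflect_apply]
  omega

end Snap

/-! ## The coarse neighbourhood of a path and its mirror -/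

section Nbhd

variable (k)

/-- **`N(Γ)`**: the union of the tiles of the (snapped) cells of `Γ`.
[cite: NewmanTassionWu2017, §3.5 (proof of Lemma 3.16, K_□ as a union of grid boxes)] -/
def snapNbhd (n : ℕ) (Γ : List (slab 3 k)) : Set (ℤ × ℤ) :=
  {z | ∃ g ∈ Γ, z ∈ sqBox (snap n (planar k g)) 40}

/-- **`τ N(Γ)`**: the mirror image of `N(Γ)` under `τ : x ↦ 14n - x`.
[cite: NewmanTassionWu2017, §3.5 (proof of Lemma 3.16, γ' = the reflection of γ)] -/
def snapNbhdR (n : ℕ) (Γ : List (slab 3 k)) : Set (ℤ × ℤ) :=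
  {z | planarReflect (14 * (n : ℤ)) z ∈ snapNbhd k n Γ}

variable {k}

/-- The mirror is an involution. [cite: NewmanTassionWu2017, §3.5 (symmetry)] -/
theorem reflect14_invol (n : ℕ) (z : ℤ × ℤ) :
    planarReflect (14 * (n : ℤ)) (planarReflect (14 * (n : ℤ)) z) = z := by
  ext <;> simp

/-- `τN` is the image of `N` under `τ`. [cite: NewmanTassionWu2017, §3.5 (γ')] -/
theorem snapNbhdR_eq_image (n : ℕ) (Γ : List (slab 3 k)) :
    snapNbhdR k n Γ = planarReflect (14 * (n : ℤ)) '' snapNbhd k n Γ := by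
  ext z
  constructor
  · intro hz
    exact ⟨planarReflect (14 * (n : ℤ)) z, hz, reflect14_invol n z⟩
  · rintro ⟨w, hw, rfl⟩
    show planarReflect (14 * (n : ℤ)) (planarReflect (14 * (n : ℤ)) w) ∈ snapNbhd k n Γ
    rw [reflect14_invol]; exact hw

/-- `z ∈ τN ↔ τ z ∈ N`. [cite: NewmanTassionWu2017, §3.5 (γ')] -/
theorem mem_snapNbhdR_iff {n : ℕ} {Γ : List (slab 3 k)} {z : ℤ × ℤ} :
    z ∈ snapNbhdR k n Γ ↔ planarReflect (14 * (n : ℤ)) z ∈ snapNbhd k n Γ := Iff.rfl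

/-- `τ z ∈ τN ↔ z ∈ N`. [cite: NewmanTassionWu2017, §3.5 (γ')] -/
theorem reflect_mem_snapNbhdR_iff {n : ℕ} {Γ : List (slab 3 k)} {z : ℤ × ℤ} :
    planarReflect (14 * (n : ℤ)) z ∈ snapNbhdR k n Γ ↔ z ∈ snapNbhd k n Γ := by
  rw [mem_snapNbhdR_iff, reflect14_invol]

/-- **`Γ̄ ⊆ N(Γ)`**: every cell of `Γ` lies in `N(Γ)` (indeed with its box of radius `20`).
[cite: NewmanTassionWu2017, §3.5 (proof of Lemma 3.16, γ̄ ⊆ R ∖ K(γ))] -/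
theorem sqBox_planar_subset_snapNbhd {n : ℕ} {Γ : List (slab 3 k)} {g : slab 3 k} (hg : g ∈ Γ) :
    sqBox (planar k g) 20 ⊆ snapNbhd k n Γ := fun _ hz => ⟨g, hg, sqBox_subset_tile n _ hz⟩

/-- `planar g ∈ N(Γ)` for `g ∈ Γ`. [cite: NewmanTassionWu2017, §3.5 (proof of Lemma 3.16)] -/
theorem planar_mem_snapNbhd {n : ℕ} {Γ : List (slab 3 k)} {g : slab 3 k} (hg : g ∈ Γ) :
    planar k g ∈ snapNbhd k n Γ := sqBox_planar_subset_snapNbhd hg (mem_sqBox_self _ _)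

/-- **`N(Γ) ⊆ 𝒩(Γ, 60)`**. [cite: NewmanTassionWu2017, §3.5 (proof of Lemma 3.16, K_□ ⊆ K(γ))] -/
theorem near_of_mem_snapNbhd {n : ℕ} {Γ : List (slab 3 k)} {z : ℤ × ℤ} (hz : z ∈ snapNbhd k n Γ) :
    Near k Γ 60 z := by
  obtain ⟨g, hg, hz⟩ := hz
  exact ⟨g, hg, tile_subset_sqBox n _ hz⟩

/-- Contrapositive: a point not within `60` of `Γ̄` is outside `N(Γ)`. [cite: NewmanTassionWu2017, §3.5 (proof of Lemma 3.16)] -/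
theorem not_mem_snapNbhd_of_not_near {n : ℕ} {Γ : List (slab 3 k)} {z : ℤ × ℤ} (hz : ¬Near k Γ 60 z) :
    z ∉ snapNbhd k n Γ := fun h => hz (near_of_mem_snapNbhd h)

/-- **`τN ∖ N` lies strictly right of the axis** when `Γ ⊆ {x ≤ 7n}`: a point of `τN` with `x ≤ 7n`
is in `N`. [cite: NewmanTassionWu2017, §3.5 (proof of Lemma 3.16, symmetry through the axis)] -/
theorem mem_snapNbhd_of_mem_snapNbhdR {n : ℕ} {Γ : List (slab 3 k)} (hΓ : ∀ g ∈ Γ, (planar k g).1 ≤ 7 * n)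
    {z : ℤ × ℤ} (hz : z ∈ snapNbhdR k n Γ) (hz7 : z.1 ≤ 7 * n) : z ∈ snapNbhd k n Γ := by
  obtain ⟨g, hg, hzg⟩ := hz
  refine ⟨g, hg, ?_⟩
  have h := reflect_mem_sqBox_of_le (n := n) (snap_fst_le n (hΓ g hg))
    (show 7 * (n : ℤ) ≤ (planarReflect (14 * (n : ℤ)) z).1 by simp only [planarReflect_apply]; omega) hzg
  rwa [reflect14_invol] at h

/-- `τN ∖ N ⊆ {x ≥ 7n+1}`. [cite: NewmanTassionWu2017, §3.5 (proof of Lemma 3.16, symmetry through the axis)] -/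
theorem fst_gt_of_mem_diff {n : ℕ} {Γ : List (slab 3 k)} (hΓ : ∀ g ∈ Γ, (planar k g).1 ≤ 7 * n)
    {z : ℤ × ℤ} (hz : z ∈ snapNbhdR k n Γ) (hzN : z ∉ snapNbhd k n Γ) : 7 * n + 1 ≤ z.1 := by
  by_contra h
  exact hzN (mem_snapNbhd_of_mem_snapNbhdR hΓ hz (by omega))

/-- `N ∖ τN ⊆ {x ≤ 7n-1}`. [cite: NewmanTassionWu2017, §3.5 (proof of Lemma 3.16, symmetry through the axis)] -/
theorem fst_lt_of_mem_diff {n : ℕ} {Γ : List (slab 3 k)} (hΓ : ∀ g ∈ Γ, (planar k g).1 ≤ 7 * n)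
    {z : ℤ × ℤ} (hz : z ∈ snapNbhd k n Γ) (hzR : z ∉ snapNbhdR k n Γ) : z.1 ≤ 7 * n - 1 := by
  by_contra h
  apply hzR
  rw [mem_snapNbhdR_iff]
  refine mem_snapNbhd_of_mem_snapNbhdR hΓ ?_ (by simp only [planarReflect_apply]; omega)
  rw [reflect_mem_snapNbhdR_iff]; exact hz

/-- `N(Γ)` lies below the row `8n + 59` when `Γ ⊆ {y ≤ 8n-1}`. [cite: NewmanTassionWu2017, §3.5 (proof of Lemma 3.16, γ ⊆ S)] -/
theorem snd_le_of_mem_snapNbhd {n : ℕ} {Γ : List (slab 3 k)} (hΓ : ∀ g ∈ Γ, (planar k g).2 ≤ 8 * n - 1)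
    {z : ℤ × ℤ} (hz : z ∈ snapNbhd k n Γ) : z.2 ≤ 8 * n + 59 := by
  obtain ⟨g, hg, hz⟩ := hz
  have h1 := hΓ g hg
  have h2 := snap_bounds n (planar k g)
  rw [mem_sqBox_iff'] at hz; push_cast at hz; omega

/-- `τN(Γ)` lies below the row `8n + 59` when `Γ ⊆ {y ≤ 8n-1}`. [cite: NewmanTassionWu2017, §3.5 (proof of Lemma 3.16)] -/
theorem snd_le_of_mem_snapNbhdR {n : ℕ} {Γ : List (slab 3 k)} (hΓ : ∀ g ∈ Γ, (planar k g).2 ≤ 8 * n - 1)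
    {z : ℤ × ℤ} (hz : z ∈ snapNbhdR k n Γ) : z.2 ≤ 8 * n + 59 := by
  have := snd_le_of_mem_snapNbhd hΓ hz
  simpa only [planarReflect_apply] using this

end Nbhd

/-! ## The gluing datum -/

section Datum

variable (k)

/-- **The gluing datum of Lemma 3.16 on the coarse-grained domain** (reflected frame of
`SlabRSWTheorem314Case2/3.lean`, realised `Γ`): `S = R' ∖ N(Γ)`, `R = R' = [0,14n]×[0,13n-1]`,
`A = C = {0}×[5n,13n-1]`, `B = τN(Γ) ∖ N(Γ)` (the mirror tiles outside the tiles), `C = τC`,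
`τ : x ↦ 14n - x`. [cite: NewmanTassionWu2017, §3.5 (Lemma 3.16: the sets K_□, Y, Y′ and γ′)] -/
def snapGlue (n : ℕ) (hn : 1 ≤ n) (Γ : List (slab 3 k)) : GlueData where
  S := (case2Setup n hn).R \ snapNbhd k n Γ
  R := (case2Setup n hn).R
  A := (case2Setup n hn).C
  B := snapNbhdR k n Γ \ snapNbhd k n Γ
  C := planarReflect (14 * (n : ℤ)) '' (case2Setup n hn).C
  hSR := Set.sdiff_subset
  hSfin := (boxR_finite _ _ _ _).subset Set.sdiff_subset
  hRfin := boxR_finite _ _ _ _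

variable {k} {n : ℕ} (hn : 1 ≤ n) (Γ : List (slab 3 k))

/-- `Q₂.S = R' ∖ N(Γ)`. [cite: NewmanTassionWu2017, §3.5 (Lemma 3.16)] -/
theorem snapGlue_S : (snapGlue k n hn Γ).S = boxR 0 (14 * n) 0 (13 * n - 1) \ snapNbhd k n Γ := rfl

/-- `Q₂.R = R'`. [cite: NewmanTassionWu2017, §3.5 (Lemma 3.16)] -/
theorem snapGlue_R : (snapGlue k n hn Γ).R = boxR 0 (14 * n) 0 (13 * n - 1) := rfl

/-- `Q₂.A = C = {0}×[5n,13n-1]`. [cite: NewmanTassionWu2017, §3.5 (Lemma 3.16, Y)] -/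
theorem snapGlue_A : (snapGlue k n hn Γ).A = sideSeg 0 (5 * n) (13 * n - 1) := rfl

/-- `Q₂.B = τN ∖ N`. [cite: NewmanTassionWu2017, §3.5 (Lemma 3.16, γ′)] -/
theorem snapGlue_B : (snapGlue k n hn Γ).B = snapNbhdR k n Γ \ snapNbhd k n Γ := rfl

/-- `Q₂.C = τC`. [cite: NewmanTassionWu2017, §3.5 (Lemma 3.16, Y′)] -/
theorem snapGlue_C : (snapGlue k n hn Γ).C = planarReflect (14 * (n : ℤ)) '' sideSeg 0 (5 * n) (13 * n - 1) := rfl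

/-- `Q₂.C` in coordinates: `{14n}×[5n,13n-1]`. [cite: NewmanTassionWu2017, §3.5 (Lemma 3.16, Y′)] -/
theorem mem_snapGlue_C_iff {z : ℤ × ℤ} :
    z ∈ (snapGlue k n hn Γ).C ↔ z.1 = 14 * n ∧ 5 * n ≤ z.2 ∧ z.2 ≤ 13 * n - 1 := by
  rw [snapGlue_C, image_planarReflect_eq, Set.mem_setOf_eq, sideSeg, Set.mem_setOf_eq]
  simp only
  omega

/-- `Q₂` has the same `R`, `C`, `A` as `mirrorGlue`, hence the same glued event `evCA`.
[cite: NewmanTassionWu2017, §3.5 (Lemma 3.16, Y ↔ Y′)] -/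
theorem snapGlue_evCA (ρ₂ : ℕ) : (snapGlue k n hn Γ).evCA k = (mirrorGlue n hn Γ ρ₂).evCA k := rfl

end Datum

end NTW17

end Literature.Probability.Percolation
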